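import Summits.HubbardSuperconductivity.HubbardSuperconductivity.Theses.AposterioriCapRg

/-!
# Crux `SsbToEvenTorusLro` (item `stmt-HubbardSuperconductivity-1315`): the discrete-Legendre telescoping
stub of card `number-legendre-recentring` is false at a boundary minimiser

Crux-triage round 1 (triager 1) support file. The card's first lemma B1 (`DiscreteLegendreRecentring` in the
ideator's workfile `Cruxes/SsbToEvenTorusLro/SketchIdeator2.lean`, announced "provable now, pure real
analysis") reads, verbatim (inlined here so that this file does not import a mutable workfile):

  for every `F : ℕ → ℝ`, `μ c : ℝ`, `n₀ N : ℕ`: if `n₀` minimises `k ↦ F k - 2μk`, and the second differences of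
  `F` lie in `[0, c]`, then `F N - 2μN - (F n₀ - 2μn₀) ≤ c (N - n₀)²/2 + c |N - n₀|`.

It is FALSE: at the BOUNDARY minimiser `n₀ = 0` optimality gives no upper bound on the first slope
`F 1 - F 0 - 2μ`, so the upward telescoping has nothing to start from (witness `F k = 100k`, `μ = c = 0`,
`n₀ = 0`, `N = 1`). The repaired statement the line actually uses (interior minimiser, `1 ≤ n₀`; in the
application `n₀ ≈ (1-δ)L²/2`) is

  `∀ F μ c n₀ N, 1 ≤ n₀ → (∀ k, F n₀ - 2μn₀ ≤ F k - 2μk) → (∀ k, 0 ≤ Δ₂F k) → (∀ k, Δ₂F k ≤ c) →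
     F N - 2μN - (F n₀ - 2μn₀) ≤ c (N - n₀)²/2 + c |N - n₀|`

(then the slope at `n₀ - 1` is `≤ 2μ`, the slope at `n₀` is `≥ 2μ`, and slope deviations telescope to
`c·d(d+1)/2` in both directions). Not proved here.
-/

set_option linter.dupNamespace false

namespace Summit.HubbardSuperconductivity.HubbardSuperconductivity.Theorems.SsbToEvenTorusLro.Negative

/-- **B1 of card `number-legendre-recentring` is false as typed** (boundary minimiser `n₀ = 0`; witness
`F k = 100 k`, `μ = c = 0`, `N = 1`). [folklore] -/
theorem discreteLegendreRecentring_false :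
    ¬ (∀ (F : ℕ → ℝ) (μ c : ℝ) (n₀ N : ℕ),
        (∀ k, F n₀ - 2 * μ * n₀ ≤ F k - 2 * μ * k) →
        (∀ k, 0 ≤ F (k + 2) - 2 * F (k + 1) + F k) →
        (∀ k, F (k + 2) - 2 * F (k + 1) + F k ≤ c) →
          F N - 2 * μ * N - (F n₀ - 2 * μ * n₀) ≤ c * ((N : ℝ) - n₀) ^ 2 / 2 + c * |(N : ℝ) - n₀|) := by
  intro h
  have := h (fun k => 100 * (k : ℝ)) 0 0 0 1
    (fun k => by have : (0:ℝ) ≤ k := Nat.cast_nonneg k; push_cast; linarith)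
    (fun k => by push_cast; linarith)
    (fun k => by push_cast; linarith)
  norm_num at this

end Summit.HubbardSuperconductivity.HubbardSuperconductivity.Theorems.SsbToEvenTorusLro.Negative
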